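import Literature.MathematicalPhysics.QuantumFieldTheory.YangMillsOS
import Literature.MathematicalPhysics.QuantumFieldTheory.LatticeGaugeProofs
import Literature.MathematicalPhysics.QuantumLattice.ContinuumLimitLGT
import Literature.MathematicalPhysics.QuantumLattice.TorusWilsonGibbs
import HarnessLib

/-!
# `HypercubicLimit`, line `conditional-mean-telescoping`: stub `stub_condMeanLocality`

Support file (`--supports stmt-QuantumFields-8646`) for crux
`Summit.QuantumFields.YangMills.Theses.PencilRigidity.HypercubicLimit`, line
`conditional-mean-telescoping`: the registered stub `stub_condMeanLocality` — **locality of the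
conditional mean (Markov property of the torus Wilson state)**.  For every cube radius `R` and
base site `x ∈ ℤ⁴`, the conditional expectation, under Wilson's measure on the torus of side
`2S+1`, of the centred plaquette at `x` given the links NOT interior to the cube `Q_R(x)` has a
version measurable with respect to the links interior to `Q_{R+1}(x)`.

Route (tree vocabulary only): the torus Wilson state is the full-volume Gibbs distribution of the
plaquette potential on the finite link set, hence a DLR state of its Gibbsian specification
(`Literature.MathematicalPhysics.QuantumLattice.isGibbsMeasure_wilsonMeasure`), so the
specification kernel `γ_Λ X` is a version of `E[X | links off Λ]`, and it reads only the links of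
plaquettes touching `Λ = Q_R(x)` and the links of `X`, all interior to `Q_{R+1}(x)`
(`stronglyMeasurable_and_ae_eq_condExp_integral_gibbsSpecOfPotential`).  The only input proved
here is the lattice geometry: a torus plaquette through a link of `Q_R(x)` is the image of a
`ℤ⁴` plaquette whose four links are interior to `Q_{R+1}(x)`.
-/

noncomputable section

open scoped SchwartzMap ENNReal
open MeasureTheory Filter Topology
open Literature.MathematicalPhysics.AQFT Literature.MathematicalPhysics.QuantumLattice
open Literature.MathematicalPhysics.QuantumFieldTheory
open Literature.Probability.LatticeModels (Torus.proj Torus.proj_apply glueWith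
  gibbsSpecOfPotential IsGibbsMeasure isSpecification_gibbsSpecOfPotential)

namespace Summit.QuantumFields.YangMills.Cruxes.HypercubicLimit.ConditionalMeanTelescoping

/-! ## Lattice geometry: plaquettes through a cube link lie in the next cube -/

section Geometry

/-- Reduction mod `L` commutes with a unit step: `proj (b + eᵢ) = proj b + eᵢ`. [folklore] -/
theorem proj_add_single (L : ℕ) (b : Literature.Probability.LatticeModels.Site 4) (i : Fin 4) :
    Torus.proj L (b + Pi.single i 1) = Torus.proj L b + Pi.single i 1 := by
  funext ν
  by_cases h : ν = i
  · subst h; simp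
  · simp [h]

/-- Reduction mod `L` commutes with a unit step backwards: `proj (b - eᵢ) = proj b - eᵢ`.
[folklore] -/
theorem proj_sub_single (L : ℕ) (b : Literature.Probability.LatticeModels.Site 4) (i : Fin 4) :
    Torus.proj L (b - Pi.single i 1) = Torus.proj L b - Pi.single i 1 := by
  funext ν
  by_cases h : ν = i
  · subst h; simp
  · simp [h]

/-- The four torus links of the plaquette `(y, i, j)` are images of the four `ℤ⁴` links of the
plaquette at a base point `b₀` above `y`; if the four vertices of that `ℤ⁴` plaquette lie in the
`ℓ^∞`-ball of radius `R + 1` about `x`, its links are interior to the cube `Q_{R+1}(x)`.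
[folklore] -/
theorem plaquetteLinks_subset_image_of_base {L R : ℕ}
    {x b₀ : Literature.Probability.LatticeModels.Site 4} {y : Site 4 L} {i j : Fin 4}
    (hy : Torus.proj L b₀ = y)
    (V1 : ∀ ν, |b₀ ν - x ν| ≤ ((R + 1 : ℕ) : ℤ))
    (V2 : ∀ ν, |(b₀ + Pi.single i 1 : Literature.Probability.LatticeModels.Site 4) ν - x ν| ≤
      ((R + 1 : ℕ) : ℤ))
    (V3 : ∀ ν, |(b₀ + Pi.single j 1 : Literature.Probability.LatticeModels.Site 4) ν - x ν| ≤
      ((R + 1 : ℕ) : ℤ))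
    (V4 : ∀ ν,
      |(b₀ + Pi.single i 1 + Pi.single j 1 : Literature.Probability.LatticeModels.Site 4) ν - x ν| ≤
        ((R + 1 : ℕ) : ℤ)) :
    (↑({(y, i), (y.shift i, j), (y.shift j, i), (y, j)} : Finset (Edge 4 L)) : Set (Edge 4 L)) ⊆
      torusEdge L ''
        {e : Literature.MathematicalPhysics.QuantumLattice.ZdEdge 4 |
          (∀ ν, |e.1 ν - x ν| ≤ ((R + 1 : ℕ) : ℤ)) ∧
          ∀ ν, |e.1 ν + (if ν = e.2 then 1 else 0) - x ν| ≤ ((R + 1 : ℕ) : ℤ)} := by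
  have key : ∀ (b : Literature.Probability.LatticeModels.Site 4) (k : Fin 4),
      (∀ ν, |b ν - x ν| ≤ ((R + 1 : ℕ) : ℤ)) →
      (∀ ν, |(b + Pi.single k 1 : Literature.Probability.LatticeModels.Site 4) ν - x ν| ≤
        ((R + 1 : ℕ) : ℤ)) →
      torusEdge L (b, k) ∈ torusEdge L ''
        {e : Literature.MathematicalPhysics.QuantumLattice.ZdEdge 4 |
          (∀ ν, |e.1 ν - x ν| ≤ ((R + 1 : ℕ) : ℤ)) ∧
          ∀ ν, |e.1 ν + (if ν = e.2 then 1 else 0) - x ν| ≤ ((R + 1 : ℕ) : ℤ)} := by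
    intro b k h1 h2
    refine Set.mem_image_of_mem _ ⟨h1, fun ν => ?_⟩
    simpa [Pi.single_apply] using h2 ν
  have hshift : ∀ (b : Literature.Probability.LatticeModels.Site 4) (k l : Fin 4),
      torusEdge L (b + Pi.single k 1, l) = (Site.shift (Torus.proj L b) k, l) := by
    intro b k l
    simp only [torusEdge, proj_add_single, Site.shift]
  intro ε hε
  simp only [Finset.coe_insert, Finset.coe_singleton, Set.mem_insert_iff,
    Set.mem_singleton_iff] at hε
  rcases hε with rfl | rfl | rfl | rfl
  · simpa [torusEdge, hy] using key b₀ i V1 V2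
  · rw [← hy, ← hshift]
    exact key _ j V2 V4
  · rw [← hy, ← hshift]
    exact key _ i V3 fun ν => by rw [add_right_comm]; exact V4 ν
  · simpa [torusEdge, hy] using key b₀ j V1 V3

/-- **A torus plaquette through a link of the cube `Q_R(x)` has all its links in `Q_{R+1}(x)`**
(on the torus, through the periodic projection `torusEdge`): if the image of a `ℤ⁴` link `e`
interior to `Q_R(x)` is one of the four links of the torus plaquette `(y, i, j)`, then all four
links are images of `ℤ⁴` links interior to `Q_{R+1}(x)` — they are the links of the `ℤ⁴`
plaquette through `e` in the plane `(i, j)`, whose vertices are one unit step from an endpoint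
of `e`. [folklore] -/
theorem plaquetteLinks_subset_image {L R : ℕ} {x : Literature.Probability.LatticeModels.Site 4}
    {e : Literature.MathematicalPhysics.QuantumLattice.ZdEdge 4}
    (he1 : ∀ ν, |e.1 ν - x ν| ≤ (R : ℤ))
    (he2 : ∀ ν, |e.1 ν + (if ν = e.2 then 1 else 0) - x ν| ≤ (R : ℤ))
    {y : Site 4 L} {i j : Fin 4}
    (hmem : torusEdge L e ∈
      ({(y, i), (y.shift i, j), (y.shift j, i), (y, j)} : Finset (Edge 4 L))) :
    (↑({(y, i), (y.shift i, j), (y.shift j, i), (y, j)} : Finset (Edge 4 L)) : Set (Edge 4 L)) ⊆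
      torusEdge L ''
        {e : Literature.MathematicalPhysics.QuantumLattice.ZdEdge 4 |
          (∀ ν, |e.1 ν - x ν| ≤ ((R + 1 : ℕ) : ℤ)) ∧
          ∀ ν, |e.1 ν + (if ν = e.2 then 1 else 0) - x ν| ≤ ((R + 1 : ℕ) : ℤ)} := by
  obtain ⟨b, k⟩ := e
  simp only [torusEdge, Finset.mem_insert, Finset.mem_singleton, Prod.mk.injEq] at hmem he1 he2
  -- every vertex of the plaquette is one unit step from an endpoint of `e = (b, k)`
  have step : ∀ (v : Literature.Probability.LatticeModels.Site 4),
      (∀ ν, |v ν - b ν| ≤ 1 ∨ |v ν - (b ν + if ν = k then 1 else 0)| ≤ 1) →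
      ∀ ν, |v ν - x ν| ≤ ((R + 1 : ℕ) : ℤ) := by
    intro v hv ν
    have h1 := he1 ν
    have h2 := he2 ν
    push_cast
    rcases hv ν with h | h <;> (rw [abs_le] at *; constructor <;> linarith [h.1, h.2])
  rcases hmem with ⟨hb, rfl⟩ | ⟨hb, rfl⟩ | ⟨hb, rfl⟩ | ⟨hb, rfl⟩
  · -- `e` is the link `(y, i)`: base point `b`
    refine plaquetteLinks_subset_image_of_base hb (step _ fun ν => ?_) (step _ fun ν => ?_)
      (step _ fun ν => ?_) (step _ fun ν => ?_) <;>
      (try simp only [Pi.add_apply, Pi.single_apply]) <;> split_ifs <;> simp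
  · -- `e` is the link `(y + eᵢ, j)`: base point `b - eᵢ`
    have hb' : Torus.proj L (b - Pi.single i 1) = y := by
      rw [proj_sub_single, hb]; simp [Site.shift]
    refine plaquetteLinks_subset_image_of_base hb' (step _ fun ν => ?_) (step _ fun ν => ?_)
      (step _ fun ν => ?_) (step _ fun ν => ?_) <;>
      (try simp only [Pi.add_apply, Pi.sub_apply, Pi.single_apply]) <;> split_ifs <;> simp
  · -- `e` is the link `(y + eⱼ, i)`: base point `b - eⱼ`
    have hb' : Torus.proj L (b - Pi.single j 1) = y := by
      rw [proj_sub_single, hb]; simp [Site.shift]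
    refine plaquetteLinks_subset_image_of_base hb' (step _ fun ν => ?_) (step _ fun ν => ?_)
      (step _ fun ν => ?_) (step _ fun ν => ?_) <;>
      (try simp only [Pi.add_apply, Pi.sub_apply, Pi.single_apply]) <;> split_ifs <;> simp
  · -- `e` is the link `(y, j)`: base point `b`
    refine plaquetteLinks_subset_image_of_base hb (step _ fun ν => ?_) (step _ fun ν => ?_)
      (step _ fun ν => ?_) (step _ fun ν => ?_) <;>
      (try simp only [Pi.add_apply, Pi.single_apply]) <;> split_ifs <;> simp

end Geometry

/-! ## The registered stub -/

/-- **stub_condMeanLocality** — locality of the conditional mean (Markov property of the torus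
Wilson state): for every compact gauge group with lattice representation data `r`, every real
`β`, torus half-side `S`, cube radius `R`, base site `x ∈ ℤ⁴` and plane `(i, j)`, the conditional
expectation under `wilsonMeasure r.ρ β` (torus of side `2S+1`) of the centred plaquette
`Re tr ρ(U_p) − ⟨Re tr ρ(U_p)⟩`, `p = (x, i, j)` read through the periodic lift, given the links
NOT in the image of `Q_R(x)`, has a version (the plaquette-specification kernel average) that is
strongly measurable with respect to the links in the image of `Q_{R+1}(x)`.  Georgii 2011
Rem. 1.24 (DLR states have the specification as conditional probabilities) with the finite range
of the plaquette interaction (Seiler LNP 159 Ch. 2). [folklore] -/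
theorem stub_condMeanLocality :
    ∀ (G : Type) [Group G] [TopologicalSpace G] [IsTopologicalGroup G] [CompactSpace G]
        [MeasurableSpace G] [BorelSpace G] (r : LatticeRep G) (β : ℝ) (S R : ℕ)
        (x : Literature.Probability.LatticeModels.Site 4) (i j : Fin 4),
      ∃ g : GaugeConfig 4 (2 * S + 1) G → ℝ,
        StronglyMeasurable[(cylinderEvents
            (torusEdge (2 * S + 1) ''
              {e : Literature.MathematicalPhysics.QuantumLattice.ZdEdge 4 |
                (∀ ν, |e.1 ν - x ν| ≤ ((R + 1 : ℕ) : ℤ)) ∧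
                ∀ ν, |e.1 ν + (if ν = e.2 then 1 else 0) - x ν| ≤ ((R + 1 : ℕ) : ℤ)}) :
            MeasurableSpace (GaugeConfig 4 (2 * S + 1) G))] g ∧
        g =ᵐ[(wilsonMeasure r.ρ β : Measure (GaugeConfig 4 (2 * S + 1) G))]
          (wilsonMeasure r.ρ β : Measure (GaugeConfig 4 (2 * S + 1) G))[fun U =>
              plaquetteObs r.ρ x i j (torusLift (2 * S + 1) U) -
                ∫ V, plaquetteObs r.ρ x i j (torusLift (2 * S + 1) V)
                  ∂(wilsonMeasure r.ρ β : Measure (GaugeConfig 4 (2 * S + 1) G)) |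
            (cylinderEvents
              (torusEdge (2 * S + 1) ''
                {e : Literature.MathematicalPhysics.QuantumLattice.ZdEdge 4 |
                  (∀ ν, |e.1 ν - x ν| ≤ R) ∧
                  ∀ ν, |e.1 ν + (if ν = e.2 then 1 else 0) - x ν| ≤ R})ᶜ :
              MeasurableSpace (GaugeConfig 4 (2 * S + 1) G))] := by
  intro G _ _ _ _ _ _ r β S R x i j
  haveI : SecondCountableTopology G :=
    (r.continuous.isClosedEmbedding r.injective).isEmbedding.secondCountableTopology
  haveI : T2Space G := (r.continuous.isClosedEmbedding r.injective).isEmbedding.t2Space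
  haveI := isProbabilityMeasure_wilsonMeasure (d := 4) (L := 2 * S + 1) r.ρ r.continuous β
  -- the plaquette potential and its Gibbsian specification, of which Wilson's measure is DLR
  obtain ⟨Φ, supp, hΦ, hΦb, hsupp, hH, hstruct⟩ :=
    exists_plaquettePotential (d := 4) (L := 2 * S + 1) r.ρ r.continuous
  have hμ : IsGibbsMeasure (gibbsSpecOfPotential (haarProbability G) Φ supp β)
      (wilsonMeasure (d := 4) (L := 2 * S + 1) r.ρ β) :=
    isGibbsMeasure_wilsonMeasure r.ρ r.continuous hΦ hΦb hsupp hH β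
  -- the cube `Q_R(x)` on the torus (a finite link set) and the next cube `Q_{R+1}(x)`
  set QR : Set (Literature.MathematicalPhysics.QuantumLattice.ZdEdge 4) :=
    {e | (∀ ν, |e.1 ν - x ν| ≤ (R : ℤ)) ∧ ∀ ν, |e.1 ν + (if ν = e.2 then 1 else 0) - x ν| ≤ (R : ℤ)}
    with hQR
  set T : Set (Edge 4 (2 * S + 1)) := torusEdge (2 * S + 1) ''
    {e : Literature.MathematicalPhysics.QuantumLattice.ZdEdge 4 |
      (∀ ν, |e.1 ν - x ν| ≤ ((R + 1 : ℕ) : ℤ)) ∧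
      ∀ ν, |e.1 ν + (if ν = e.2 then 1 else 0) - x ν| ≤ ((R + 1 : ℕ) : ℤ)} with hT
  set Λ : Finset (Edge 4 (2 * S + 1)) := (Set.toFinite (torusEdge (2 * S + 1) '' QR)).toFinset
    with hΛ
  have hΛc : (↑Λ : Set (Edge 4 (2 * S + 1))) = torusEdge (2 * S + 1) '' QR :=
    Set.Finite.coe_toFinset _
  -- every interaction set meeting `Λ` lies in `T`
  have hsuppT : ∀ A ∈ supp Λ, (A ∩ Λ).Nonempty → (↑A : Set (Edge 4 (2 * S + 1))) ⊆ ↑Λ ∪ T := by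
    intro A hA hne
    obtain ⟨y, i', j', -, rfl⟩ := hstruct Λ A hA
    obtain ⟨ε, hε⟩ := hne
    rw [Finset.mem_inter] at hε
    have hεΛ : ε ∈ torusEdge (2 * S + 1) '' QR := by rw [← hΛc]; exact Finset.mem_coe.2 hε.2
    obtain ⟨e, ⟨he1, he2⟩, rfl⟩ := hεΛ
    exact (plaquetteLinks_subset_image he1 he2 hε.1).trans Set.subset_union_right
  -- the centred plaquette: bounded, measurable, reads only links in `T`
  set X : GaugeConfig 4 (2 * S + 1) G → ℝ := fun U =>
    plaquetteObs r.ρ x i j (torusLift (2 * S + 1) U) -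
      ∫ V, plaquetteObs r.ρ x i j (torusLift (2 * S + 1) V)
        ∂(wilsonMeasure r.ρ β : Measure (GaugeConfig 4 (2 * S + 1) G)) with hX
  have hPm : Measurable fun U : GaugeConfig 4 (2 * S + 1) G =>
      plaquetteObs r.ρ x i j (torusLift (2 * S + 1) U) :=
    (measurable_plaquetteObs r.ρ r.continuous x i j).comp (measurable_torusLift (2 * S + 1))
  have hXm : Measurable X := hPm.sub measurable_const
  have hPb : ∀ U : GaugeConfig 4 (2 * S + 1) G,
      |plaquetteObs r.ρ x i j (torusLift (2 * S + 1) U)| ≤ r.N := fun U =>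
    abs_plaquetteObs_le_holds (ρ := r.ρ) r.mem_unitary x i j _
  have hXb : ∀ U, |X U| ≤ 2 * r.N := by
    intro U
    have hint : |∫ V, plaquetteObs r.ρ x i j (torusLift (2 * S + 1) V)
        ∂(wilsonMeasure r.ρ β : Measure (GaugeConfig 4 (2 * S + 1) G))| ≤ r.N := by
      refine (abs_integral_le_integral_abs).trans ?_
      calc ∫ V, |plaquetteObs r.ρ x i j (torusLift (2 * S + 1) V)|
            ∂(wilsonMeasure r.ρ β : Measure (GaugeConfig 4 (2 * S + 1) G))
          ≤ ∫ _, (r.N : ℝ) ∂(wilsonMeasure r.ρ β : Measure (GaugeConfig 4 (2 * S + 1) G)) :=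
            integral_mono_of_nonneg (Eventually.of_forall fun _ => abs_nonneg _)
              (integrable_const _) (Eventually.of_forall hPb)
        _ = r.N := by simp
    calc |X U| ≤ |plaquetteObs r.ρ x i j (torusLift (2 * S + 1) U)| +
          |∫ V, plaquetteObs r.ρ x i j (torusLift (2 * S + 1) V)
            ∂(wilsonMeasure r.ρ β : Measure (GaugeConfig 4 (2 * S + 1) G))| := abs_sub _ _
      _ ≤ r.N + r.N := add_le_add (hPb U) hint
      _ = 2 * r.N := by ring
  have hXdep : DependsOn X (↑Λ ∪ T) := by
    intro U U' h
    have hT1 : ∀ (b : Literature.Probability.LatticeModels.Site 4) (k : Fin 4),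
        (∀ ν, |b ν - x ν| ≤ ((R + 1 : ℕ) : ℤ)) →
        (∀ ν, |(b + Pi.single k 1 : Literature.Probability.LatticeModels.Site 4) ν - x ν| ≤
          ((R + 1 : ℕ) : ℤ)) →
        U (torusEdge (2 * S + 1) (b, k)) = U' (torusEdge (2 * S + 1) (b, k)) := by
      intro b k h1 h2
      refine h _ (Or.inr (Set.mem_image_of_mem _ ⟨h1, fun ν => ?_⟩))
      simpa [Pi.single_apply] using h2 ν
    have near : ∀ (v : Literature.Probability.LatticeModels.Site 4), (∀ ν, |v ν - x ν| ≤ 1) →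
        ∀ ν, |v ν - x ν| ≤ ((R + 1 : ℕ) : ℤ) :=
      fun v hv ν => (hv ν).trans (by push_cast; linarith)
    have h0 : ∀ ν, |x ν - x ν| ≤ (1 : ℤ) := fun ν => by simp
    have h1 : ∀ (k : Fin 4) (ν : Fin 4),
        |(x + Pi.single k 1 : Literature.Probability.LatticeModels.Site 4) ν - x ν| ≤ (1 : ℤ) := by
      intro k ν
      by_cases hk : ν = k <;> simp [hk]
    simp only [hX, plaquetteObs, plaquetteHolonomyZd, torusLift, Function.comp_apply]
    by_cases hij : i = j
    · subst hij
      simp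
    · have h2 : ∀ ν,
          |(x + Pi.single i 1 + Pi.single j 1 : Literature.Probability.LatticeModels.Site 4) ν - x ν| ≤
            (1 : ℤ) := by
        intro ν
        by_cases hi : ν = i
        · simp [hi, hij]
        · by_cases hj : ν = j
          · simp [hj, Ne.symm hij]
          · simp [hi, hj]
      have h2' : ∀ ν,
          |(x + Pi.single j 1 + Pi.single i 1 : Literature.Probability.LatticeModels.Site 4) ν - x ν| ≤
            (1 : ℤ) :=
        fun ν => by rw [add_right_comm]; exact h2 ν
      rw [hT1 x i (near _ h0) (near _ (h1 i)), hT1 _ j (near _ (h1 i)) (near _ h2),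
        hT1 _ i (near _ (h1 j)) (near _ h2'), hT1 x j (near _ h0) (near _ (h1 j))]
  -- the Markov property of the plaquette specification
  obtain ⟨hgm, hgae⟩ := stronglyMeasurable_and_ae_eq_condExp_integral_gibbsSpecOfPotential
    (haarProbability G) hΦ hΦb hsupp β hμ Λ hsuppT hXm hXb hXdep
  rw [hΛc] at hgae
  exact ⟨fun η => ∫ σ, X σ ∂(gibbsSpecOfPotential (haarProbability G) Φ supp β Λ η), hgm, hgae⟩

end Summit.QuantumFields.YangMills.Cruxes.HypercubicLimit.ConditionalMeanTelescoping
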